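import Mathlib
import HarnessLib

/-!
# Petrow–Young (2023), §1.1–§1.2 and §1.6: the Weyl bound for all Dirichlet `L`-functions
# (Theorem 1.1), the fourth moment along a coset (Theorem 1.4), character sums (Theorem 1.6)

Topic `Literature/NumberTheory/LFunctions` (namespace `Literature.NumberTheory.LFunctions`; the
paper's one internal object, the integer `q*`, lives in the sub-namespace `PetrowYoung2023`).
STATEMENT LAYER (D-0014): three NAMED FACTS (`def … : Prop`, theorems in print, nothing asserted,
nothing proved about them here) — Theorem 1.1, Theorem 1.4, Theorem 1.6 — plus PROVED bookkeeping:
the half-line form of Theorem 1.1 that is, binder for binder, the hypothesis `hF` of the tree's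
`Literature.NumberTheory.LFunctions.Zhang2022.Skeleton.lemma32_holds_of_subconvexity`
(campaign FACT F-15 "in the printed shape of the Weyl-strength subconvexity bound", which that
file carries as a HYPOTHESIS and cites as `[PetrowYoung2023, Thm 1.1]`; typed here once so that
users can name it), and the arithmetic of `q*` (`q* = p^{⌈2β/3⌉}` on prime powers, `q² ∣ (q*)³`).
Typed for the cell `landau-siegel` (LS programme §C harvest, topic r8 "moment technology with
power savings"): tag **none** at the knife edges (it is the critical-line size input of §3 of
arXiv:2211.02515, not an E*-len / E*-ℓ estimate); "what it would need to bite": nothing further —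
with it, the §3 leaf `Skeleton.Lemma32` is a theorem modulo a theorem-in-print
(`Zhang2022/Section3Lemma32OfWeylBound.lean`).

## What the source prints (held text `paper:arxiv-1908.10346`, corpus-tex, 38 chunks, read 2026-08-26)

I. Petrow, M. P. Young, *The fourth moment of Dirichlet L-functions along a coset and the Weyl
bound*, Duke Math. J. **172** (2023), no. 10, 1879–1960 = arXiv:1908.10346 [PetrowYoung2023].
Theorem numbers below are those of the arXiv text (§1.1 "The Weyl bound and cubic moments",
§1.2 "The fourth moment problem along subgroups", §1.6 "Bounds on character sums").

> **Theorem 1.1** (chunk p0003:L7–L13). For any primitive Dirichlet character `χ` modulo `q` and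
> `ε > 0`, we have `L(1/2 + it, χ) ≪_ε (q(1 + |t|))^{1/6+ε}`.
> "In another language, for any Hecke character `χ` over `ℚ`, we have `L(1/2,χ) ≪_ε C(χ)^{1/6+ε}`
> where `C(χ)` is the analytic conductor of `χ`."

> **Theorem 1.2** (p0003:L19–L29). There exists a `B > 2` such that for all primitive `χ` modulo
> `q` not quadratic and `ε > 0` we have
> `Σ_{|t_j| ≤ T} Σ_{m∣q} Σ_{π ∈ 𝓗_{it_j}(m, χ̄²)} L(1/2, π ⊗ χ)³ + ∫_{−T}^{T} |L(1/2+it,χ)|⁶ dt ≪_ε T^B q^{1+ε}`.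
> **Theorem 1.3** (p0003:L31–L41). For all primitive `χ` modulo `q`, `δ, ε > 0`, and `T ≫ q^δ`:
> `Σ_{T ≤ t_j < T+1} Σ_{m∣q} Σ_{π ∈ 𝓗_{it_j}(m, χ̄²)} L(1/2, π ⊗ χ)³ + ∫_T^{T+1} |L(1/2+it,χ)|⁶ dt ≪_{δ,ε} T^{1+ε} q^{1+ε}`.
> (`𝓗_{it}(m,ψ)` = Hecke–Maass newforms of conductor `m`, central character `ψ`, spectral
> parameter `it`; "These two theorems, with the additional hypothesis that `q` is cube-free,
> appeared as Theorems 1.1 and 1.2 of [PetrowYoung]"; non-negativity `L(1/2, π ⊗ χ) ≥ 0` by Guo.)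

> **§1.2, standing data** (p0004:L14–L16). "Let `T ≥ 1`, and `q, d ≥ 1` be integers with `d ∣ q`.
> Let `q* = Π_{p^β ∥ q} p^{⌈2β/3⌉}`, so that `q*` is the least positive integer so that
> `q² ∣ (q*)³`."
> **Theorem 1.4** (p0004:L18–L26). For all primitive `α` modulo `q` and `ε > 0` we have
> `∫_{−T}^{T} Σ_{ψ (mod d)} |L(1/2 + it, ψ.α)|⁴ ≪_ε T · lcm(d, q*) · (qT)^ε`.
> "Note that the set of characters `{α.ψ : ψ (mod d)}` is a coset of the subgroup of characters
> modulo `d` inside the group of all characters modulo `q`."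

> **Theorem 1.6** (p0007:L1–L10). For all primitive Dirichlet characters `χ` modulo `q`, `x ≥ 1`,
> and `ε > 0` we have `Σ_{n ≤ x} χ(n) ≪ x^{1/2} q^{11/64+ε}` and `≪ x^{8/15} q^{7/45+ε}`.
> "Remarks. The former bound is better than the latter for `x ≫ q^{47/96}`."

## Lean rendering / design choices (audit notes for ls-lit-ref)

* `L(s,χ)` is Mathlib's `DirichletCharacter.LFunction χ s` (the entire continuation; modulus
  `q ≥ 1` as `[NeZero q]`); "primitive" is Mathlib's `DirichletCharacter.IsPrimitive`. `q = 1`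
  (the trivial character, `L = ζ`) is INCLUDED in Theorems 1.1 and 1.4, as printed ("for any Hecke
  character over `ℚ`"): there they are the classical `t`-aspect Weyl bound / fourth-moment bound
  for `ζ`. In Theorem 1.6 the principal character must be EXCLUDED (`Σ_{n≤x} 1 = ⌊x⌋` is not
  `≪ x^{1/2}`; the printed proof runs through Burgess, i.e. `χ` non-principal): rendered as the
  explicit guard `χ ≠ 1`, which for a primitive character is exactly `q ≠ 1`.
* `≪_ε`: "`∀ ε > 0, ∃ C`" OUTERMOST — the constant depends on `ε` only and is uniform in `q`, `χ`,
  `t` (Thm 1.1), in `q, d, α, T ≥ 1` (Thm 1.4), in `q, χ, x ≥ 1` (Thm 1.6), as printed. Real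
  powers are `Real.rpow` of non-negative reals.
* Theorem 1.4: `ψ (mod d)` ranges over ALL Dirichlet characters modulo `d` (Mathlib's
  `Fintype (DirichletCharacter ℂ d)`), `ψ.α` is the level-`q` character
  `DirichletCharacter.changeLevel (d ∣ q) ψ * α`, and `L(1/2+it, ψ.α)` is the `L`-function of that
  (possibly imprimitive) level-`q` character — the Dirichlet series `Σ (ψα)(n) n^{−s}` with
  `(ψα)(n) = 0` for `(n,q) > 1`, which is what §5 of the source expands (p0016: the approximate
  functional equation with coefficients `τ(n)ψ(n)χ(n)`). Replacing it by the `L`-function of the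
  inducing primitive character changes `|L|⁴` by a factor between `Π_{p∣q}(1+p^{−1/2})^{−4}` and
  `Π_{p∣q}(1−p^{−1/2})^{−4}`, both `q^{o(1)}`, so either reading is the printed statement at the
  `(qT)^ε` scale; we type the one the proof uses. The `dt`-integral is Mathlib's interval integral
  (the integrand is continuous, so no junk value arises).
* `q*` is `PetrowYoung2023.qStar q = q.factorization.prod (p, β) ↦ p^{⌈2β/3⌉}` with
  `⌈2β/3⌉ = (2β+2)/3` in `ℕ`; `qStar 0 = 1` is a harmless junk value (moduli are `≥ 1`).
* NOT typed: Theorems 1.2, 1.3 and 1.5 (cubic moments over Hecke–Maass newforms `π` of level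
  `m ∣ q` with `L(1/2, π ⊗ χ)`; the shifted divisor sum `S(χ)`): Mathlib has no Maass newforms or
  automorphic `L`-functions to state them over, and a home-made carrier would be an unreviewable
  paraphrase. Their GL(1) shadow — the sixth-moment term alone is `≪_ε T^B q^{1+ε}` because the
  spectral terms are non-negative (Guo) — is a consequence the source does not print as a theorem
  and is deliberately not minted as a fact here.

WHAT THIS IS NOT: no claim about Landau–Siegel zeros, about Theorems 1–2 of arXiv:2211.02515 or a
repaired `Margin232`; the programme SEARCHES and TYPES. Typing a printed theorem is transcription.

## References

* [PetrowYoung2023] Theorems 1.1, 1.4, 1.6; §1.2 (definition of `q*`); §5 (the reduction, for the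
  reading of `L(s, ψ.α)`); Theorems 1.2/1.3/1.5 quoted, not typed.
* Tree: `Zhang2022/Section3Lemma32Holds.lean` (`lemma32_holds_of_subconvexity`, the consumer of the
  half-line form), `Zhang2022/Section3SubconvexInput.lean` (`saves_lemma32_weyl`, the exponent
  bookkeeping `μ = 1/6`).
-/

noncomputable section

open Complex

namespace Literature.NumberTheory.LFunctions

namespace PetrowYoung2023

/-! ### Vocabulary of §1.2 -/

/-- **`q* = Π_{p^β ∥ q} p^{⌈2β/3⌉}`**, "the least positive integer so that `q² ∣ (q*)³`"
(`⌈2β/3⌉ = (2β + 2)/3` in natural-number division; `qStar 0 = 1` is a junk value, the source has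
`q ≥ 1`). [cite: PetrowYoung2023, §1.2 (before Theorem 1.4)] -/
def qStar (q : ℕ) : ℕ :=
  q.factorization.prod fun p β => p ^ ((2 * β + 2) / 3)

/-- `q* = 1` for `q = 1`. [cite: PetrowYoung2023, §1.2 (before Theorem 1.4)] -/
@[simp] theorem qStar_one : qStar 1 = 1 := by
  simp [qStar]

/-- On a prime power, `q* = p^{⌈2β/3⌉}`. [cite: PetrowYoung2023, §1.2 (before Theorem 1.4)] -/
theorem qStar_prime_pow {p : ℕ} (hp : p.Prime) (β : ℕ) :
    qStar (p ^ β) = p ^ ((2 * β + 2) / 3) := by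
  unfold qStar
  rw [Nat.Prime.factorization_pow hp, Finsupp.prod_single_index (by simp)]

/-- `q* = p` for a prime `q = p` (`⌈2/3⌉ = 1`). [cite: PetrowYoung2023, §1.2 (before Theorem 1.4)] -/
theorem qStar_prime {p : ℕ} (hp : p.Prime) : qStar p = p := by
  simpa using qStar_prime_pow hp 1

/-- The source's running example: `q = p³` has `q* = p²`.
[cite: PetrowYoung2023, §1.2 (after Theorem 1.4)] -/
theorem qStar_prime_cube {p : ℕ} (hp : p.Prime) : qStar (p ^ 3) = p ^ 2 := by
  simpa using qStar_prime_pow hp 3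

/-- The factorization of `q*`: the exponent of `p` is `⌈2β/3⌉` where `β` is that of `q`.
[cite: PetrowYoung2023, §1.2 (before Theorem 1.4)] -/
theorem factorization_qStar (q : ℕ) :
    (qStar q).factorization = q.factorization.mapRange (fun β => (2 * β + 2) / 3) rfl := by
  have h : qStar q = (q.factorization.mapRange (fun β => (2 * β + 2) / 3) rfl).prod (· ^ ·) := by
    unfold qStar
    rw [Finsupp.prod_mapRange_index fun p => pow_zero p]
  rw [h]
  apply Nat.prod_pow_factorization_eq_self
  intro p hp
  exact Nat.prime_of_mem_primeFactors (Finsupp.support_mapRange hp)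

/-- `q*` is positive. [cite: PetrowYoung2023, §1.2 (before Theorem 1.4)] -/
theorem qStar_pos (q : ℕ) : 0 < qStar q := by
  unfold qStar
  rw [Finsupp.prod]
  refine Finset.prod_pos fun p hp => pow_pos ?_ _
  exact (Nat.prime_of_mem_primeFactors hp).pos

/-- **`q² ∣ (q*)³`** (the defining property printed in §1.2: `2β ≤ 3⌈2β/3⌉` prime by prime).
[cite: PetrowYoung2023, §1.2 (before Theorem 1.4)] -/
theorem sq_dvd_qStar_cube {q : ℕ} (hq : q ≠ 0) : q ^ 2 ∣ qStar q ^ 3 := by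
  rw [← Nat.factorization_le_iff_dvd (pow_ne_zero 2 hq) (pow_ne_zero 3 (qStar_pos q).ne'),
    Nat.factorization_pow, Nat.factorization_pow, factorization_qStar]
  intro p
  simp only [Finsupp.smul_apply, smul_eq_mul, Finsupp.mapRange_apply]
  omega

end PetrowYoung2023

open PetrowYoung2023

/-! ### The named facts -/

/-- **Petrow–Young 2023, Theorem 1.1 (the Weyl bound for all Dirichlet `L`-functions).** "For any
primitive Dirichlet character `χ` modulo `q` and `ε > 0`, we have
`L(1/2 + it, χ) ≪_ε (q(1 + |t|))^{1/6+ε}`." Rendered: for every `ε > 0` there is `C = C(ε)` with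
`‖L(1/2 + it, χ)‖ ≤ C · (q(1+|t|))^{1/6+ε}` for every modulus `q ≥ 1`, every primitive `χ` mod `q`
and every real `t` (the trivial character, `q = 1`, `L = ζ`, included as printed). A theorem in
print (it completes Conrey–Iwaniec 2000 for real `χ` and Petrow–Young 2020 for cube-free `q`);
NAMED FACT, not proved here. [cite: PetrowYoung2023, Theorem 1.1] -/
def petrowYoung2023_theorem11 : Prop :=
  ∀ ε : ℝ, 0 < ε → ∃ C : ℝ,
    ∀ (q : ℕ) [NeZero q] (χ : DirichletCharacter ℂ q), χ.IsPrimitive →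
      ∀ t : ℝ, ‖χ.LFunction (1 / 2 + t * I)‖ ≤ C * ((q : ℝ) * (1 + |t|)) ^ (1 / 6 + ε)

/-- **Petrow–Young 2023, Theorem 1.4 (Lindelöf on average for the fourth moment along a coset).**
"Let `T ≥ 1`, and `q, d ≥ 1` be integers with `d ∣ q` … For all primitive `α` modulo `q` and
`ε > 0` we have `∫_{−T}^{T} Σ_{ψ (mod d)} |L(1/2 + it, ψ.α)|⁴ ≪_ε T · lcm(d, q*) · (qT)^ε`."
Rendered: for every `ε > 0` there is `C = C(ε)` such that for all `q ≥ 1`, `d ∣ q`, primitive `α`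
mod `q` and `T ≥ 1`, the interval integral over `[−T, T]` of the sum over ALL characters `ψ` mod
`d` of `‖L(1/2+it, ψ.α)‖⁴` — `ψ.α` the level-`q` character `changeLevel ψ · α`, `L` its (possibly
imprimitive) Dirichlet `L`-function, as in §5 of the source — is at most
`C · T · lcm(d, q*) · (qT)^ε`. NAMED FACT, not proved here. [cite: PetrowYoung2023, Theorem 1.4] -/
def petrowYoung2023_theorem14 : Prop :=
  ∀ ε : ℝ, 0 < ε → ∃ C : ℝ,
    ∀ (q d : ℕ) [NeZero q] (hdq : d ∣ q) (α : DirichletCharacter ℂ q), α.IsPrimitive →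
      ∀ T : ℝ, 1 ≤ T →
        ∫ t in (-T)..T,
            ∑ ψ : DirichletCharacter ℂ d,
              ‖(DirichletCharacter.changeLevel hdq ψ * α).LFunction (1 / 2 + t * I)‖ ^ 4
          ≤ C * T * (Nat.lcm d (qStar q) : ℝ) * ((q : ℝ) * T) ^ ε

/-- **Petrow–Young 2023, Theorem 1.6 (character sums beyond Burgess for `r = 2, 3`).** "For all
primitive Dirichlet characters `χ` modulo `q`, `x ≥ 1`, and `ε > 0` we have
`Σ_{n ≤ x} χ(n) ≪ x^{1/2} q^{11/64+ε}` and `≪ x^{8/15} q^{7/45+ε}`." Rendered with BOTH bounds (the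
printed brace), `∀ ε > 0, ∃ C(ε)` uniform in `q, χ, x ≥ 1`, for primitive NON-PRINCIPAL `χ`
(`χ ≠ 1`, i.e. `q ≠ 1`: the printed proof is Theorem 1.1 + Burgess on a short interval, and the
display is false for the trivial character — see the module docstring). NAMED FACT, not proved
here. [cite: PetrowYoung2023, Theorem 1.6] -/
def petrowYoung2023_theorem16 : Prop :=
  ∀ ε : ℝ, 0 < ε → ∃ C : ℝ,
    ∀ (q : ℕ) [NeZero q] (χ : DirichletCharacter ℂ q), χ.IsPrimitive → χ ≠ 1 →
      ∀ x : ℝ, 1 ≤ x →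
        ‖∑ n ∈ Finset.Icc 1 ⌊x⌋₊, χ (n : ZMod q)‖ ≤
            C * x ^ (1 / 2 : ℝ) * (q : ℝ) ^ (11 / 64 + ε) ∧
          ‖∑ n ∈ Finset.Icc 1 ⌊x⌋₊, χ (n : ZMod q)‖ ≤
            C * x ^ (8 / 15 : ℝ) * (q : ℝ) ^ (7 / 45 + ε)

/-! ### Proved bookkeeping -/

/-- A point on the critical line is `1/2 + i·(im s)`. [folklore] -/
private theorem eq_half_add_im_mul_I {s : ℂ} (hs : s.re = 1 / 2) : s = 1 / 2 + (s.im : ℝ) * I := by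
  apply Complex.ext <;> simp [hs]

/-- **Theorem 1.1 in half-line form** — binder for binder the hypothesis `hF` of the tree's
`Zhang2022.Skeleton.lemma32_holds_of_subconvexity` ("every primitive `θ` to every modulus `q ≥ 1`
satisfies `‖L(s,θ)‖ ≤ C · (q(1+|im s|))^{1/6+ε}` for all `s` with `re s = ½`"), for every `ε > 0`.
[cite: PetrowYoung2023, Theorem 1.1] -/
theorem petrowYoung2023_theorem11.halfLine (h : petrowYoung2023_theorem11) {ε : ℝ} (hε : 0 < ε) :
    ∃ C : ℝ, ∀ (q : ℕ) [NeZero q] (θ : DirichletCharacter ℂ q), θ.IsPrimitive →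
      ∀ s : ℂ, s.re = 1 / 2 →
        ‖θ.LFunction s‖ ≤ C * ((q : ℝ) * (1 + |s.im|)) ^ (1 / 6 + ε) := by
  obtain ⟨C, hC⟩ := h ε hε
  refine ⟨C, fun q _ θ hθ s hs => ?_⟩
  have h1 := hC q θ hθ s.im
  rwa [← eq_half_add_im_mul_I hs] at h1

/-- **Theorem 1.1 at `t = 0`**: `‖L(1/2, χ)‖ ≤ C(ε) q^{1/6+ε}` for every primitive `χ` mod `q`
(the `q`-aspect Weyl bound at the central point). [cite: PetrowYoung2023, Theorem 1.1] -/
theorem petrowYoung2023_theorem11.central (h : petrowYoung2023_theorem11) {ε : ℝ} (hε : 0 < ε) :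
    ∃ C : ℝ, ∀ (q : ℕ) [NeZero q] (χ : DirichletCharacter ℂ q), χ.IsPrimitive →
      ‖χ.LFunction (1 / 2)‖ ≤ C * (q : ℝ) ^ (1 / 6 + ε) := by
  obtain ⟨C, hC⟩ := h ε hε
  refine ⟨C, fun q _ χ hχ => ?_⟩
  simpa using hC q χ hχ 0

/-- The two exponent pairs of Theorem 1.6 cross at `x = q^{47/96}`:
`x^{1/2} q^{11/64} = x^{8/15} q^{7/45}` iff `x^{1/30} = q^{47/2880}`, i.e. `(1/30)·(47/96) = 11/64 − 7/45`
("The former bound is better than the latter for `x ≫ q^{47/96}`").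
[cite: PetrowYoung2023, Theorem 1.6 (Remarks)] -/
theorem petrowYoung2023_theorem16.crossover :
    (8 / 15 - 1 / 2 : ℚ) * (47 / 96) = 11 / 64 - 7 / 45 := by
  norm_num

end Literature.NumberTheory.LFunctions
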